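import Summits.BirchSwinnertonDyer.BirchSwinnertonDyer.Theorems.PrintX11aUpperNonSurjFiveExcToolkitRoots
import Summits.BirchSwinnertonDyer.BirchSwinnertonDyer.Theorems.KimAtThreeDeepLowerOffStratumLevelLoweringMultiStabIhara
import HarnessLib

/-!
# Crux U5 `PrintX11a.UpperNonSurjFive` (item stmt-BirchSwinnertonDyer-20614), line «gl1cartan5», EXCEPTIONAL-ZERO road:
# THEOREM D″ at a GENERAL odd prime `p` — the non-degeneracy of the stabilised plus symbol of `G = Σ cᵢ φᵢ` from Ihara's lemma
# (`ribet1984_iharaLemma`) BY NAME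

Cell `bsd-print-x11a`, seat `cruxlead-stmt-BirchSwinnertonDyer-20614` (LEAD g6); `--supports stmt-BirchSwinnertonDyer-20614`,
closes nothing. File 5 of the EXCEPTIONAL-ZERO road: the bsd-addord acc2 theorem
`KimAtThreeDeepLowerOffStratumLevelLoweringMultiStabIhara.exists_valuation_stabilisedSymbol_eq_one_sum_smul_of_ribet1984_iharaLemma`
RE-PROVED over `ℚ̄_p = PadicAlgCl p` for an arbitrary ODD prime `p` (the residue field `𝓀 = 𝒪_{ℚ̄_p}/𝔪` has characteristic `p`, so
`𝕋̃/ker χ` is a finite domain; `2 ≠ 0` in `𝓀` needs `p ≠ 2`); proof copied letter for letter; cell b2b-bsdres'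
`LevelLowering.exists_sub_mul_apply_ne_zero_of_ribet1984_iharaLemma` (already `p`-free) is the engine. Let `φᵢ ∈ S₂(Γ₀(N))` have
real coefficients with `T_r φᵢ = e(r) φᵢ` for the primes `r ∤ Nq` (`e(r)` real algebraic integers), `G = Σ cᵢ φᵢ`, `q ∤ N` prime
(on the exceptional-zero road `q = p`, `N` = conductor`/p`), `Ω` with `plusSymbol G/Ω` integral on `ℚ` and a unit on one cycle, a
prime `r₀ ≡ 1 (mod Nq)` with `e(r₀) − r₀ − 1` a unit, and `w ≡ 1`: then `(plusSymbol G x₀ − w·plusSymbol G (q x₀))/Ω` is a unit for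
some `x₀`. Theorems only; no definition, no named fact, no `sorry`; BSD is not proved by any of this.

## References

* K. A. Ribet, *Congruence relations between modular forms*, Proc. ICM 1983 (1984), Thm. 4.1 [Ribet1984ICM]; H. Darmon, F. Diamond,
  R. Taylor, *Fermat's Last Theorem* (1995), Lemma 4.28 (a), Lemma 4.30 (b), §4.5 pp. 135–137, §4.3 p. 120 [DarmonDiamondTaylor1995];
  J. E. Cremona (1997), §2.4 [CremonaAlgorithms1997]; F. Diamond, J. Shurman (2005), Prop. 5.6.2, Prop. 5.8.5 [DiamondShurman2005].
-/

set_option autoImplicit false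
-- the Theorems namespace of a single-conjunct summit repeats the summit name by design (D-0017)
set_option linter.dupNamespace false

noncomputable section

open scoped MatrixGroups ModularForm Classical NNReal

open CongruenceSubgroup WeierstrassCurve Literature.NumberTheory.EllipticCurves
  Literature.NumberTheory.EllipticCurves.ModularForms
open UpperHalfPlane hiding I

namespace Summit.BirchSwinnertonDyer.BirchSwinnertonDyer.Theorems.GL1Cartan.Exc

open Literature.NumberTheory.Automorphic (PadicAlgCl.norm_le_one_of_isIntegral)
open Summit.BirchSwinnertonDyer.BirchSwinnertonDyer.Theorems.KimAtThreeDeepLowerOffStratumLevelLoweringMultiStabPeriod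
  (plusSymbol_sum_smul_eq_re)
open Summit.BirchSwinnertonDyer.BirchSwinnertonDyer.Theorems.KimAtThreeDeepLowerOffStratumLevelLoweringMultiStabIhara
  (exists_eigenvalue_primeTo_family)

section Ihara

open Summit.BirchSwinnertonDyer.Rank1Residual.LevelLowering

variable {p : ℕ} [Fact p.Prime] {N q : ℕ} [NeZero N] {I : Type*} [Fintype I] {φ : I → CuspForm (Gamma0 N) 2} {e : ℕ → ℂ}

/-- ★ **THEOREM D″ — the NON-DEGENERACY input of THEOREM A for `G = Σ cᵢ φᵢ` from `ribet1984_iharaLemma` BY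
NAME.** Let `φᵢ ∈ S₂(Γ₀(N))` (`i ∈ I` finite) have REAL coefficients and satisfy `T_r φᵢ = e(r) φᵢ` for every
prime `r ∤ Nq`, `e(r)` a real algebraic integer; `cᵢ ∈ ℂ`, `G = Σ cᵢ φᵢ`, `q ∤ N` a prime, `Ω ∈ ℂ` with
`plusSymbol G x/Ω` integral for all `x ∈ ℚ` and a UNIT at some cusp `γ₀∞`, `γ₀ ∈ Γ₀(N)`, a prime
`r₀ ≡ 1 (mod Nq)`, `r₀ ∤ Nq`, with `e(r₀) ≢ r₀ + 1 (mod 𝔪)`, and `w ≡ 1`. Then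
`(plusSymbol G x₀ − w·plusSymbol G (q x₀))/Ω` is a unit for some `x₀ ∈ ℚ`. Proof = THEOREM D/D′'s, with the cycle
functional `Λ(y) = ((Σ cᵢ Re y(φᵢ))/Ω mod 𝔪)` and the eigencharacter of §1.
[cite: Ribet1984ICM, Thm. 4.1] [cite: DarmonDiamondTaylor1995, Lemma 4.28 (a), Lemma 4.30 (b), §4.5 pp. 135–137]
[cite: CremonaAlgorithms1997, §2.4] -/
theorem exists_valuation_stabilisedSymbol_eq_one_sum_smul_of_ribet1984_iharaLemma (hI : ribet1984_iharaLemma)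
    (hq : q.Prime) (hqN : ¬ q ∣ N)
    (hφT : ∀ (i : I) (r : ℕ) (hr : r.Prime), ¬ r ∣ N * q →
      (haveI : NeZero r := ⟨hr.ne_zero⟩; heckeT (Gamma0 N) 2 r (φ i)) = e r • φ i)
    (he : ∀ r : ℕ, r.Prime → ¬ r ∣ N * q → IsIntegral ℤ (e r) ∧ (e r).im = 0)
    (hreal : ∀ i n, (cuspCoeff (φ i) n).im = 0) (c : I → ℂ) (ι : PadicAlgCl p ≃+* ℂ) (hp2 : p ≠ 2) {Ω : ℂ}
    (hΩint : ∀ x : ℚ, Valued.v (ι.symm (plusSymbol (∑ i, c i • φ i) x / Ω)) ≤ 1)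
    (γ₀ : Gamma0 N) (hγ₀ : (γ₀ : SL(2, ℤ)) 1 0 ≠ 0)
    (hunit : Valued.v (ι.symm (plusSymbol (∑ i, c i • φ i)
      ((((γ₀ : SL(2, ℤ)) 0 0 : ℤ) : ℚ) / (((γ₀ : SL(2, ℤ)) 1 0 : ℤ) : ℚ)) / Ω)) = 1)
    {r₀ : ℕ} (hr₀ : r₀.Prime) (hr₀S : ¬ r₀ ∣ N * q) (hr₀1 : r₀ ≡ 1 [MOD N * q])
    (hE₀ : Valued.v (ι.symm (e r₀ - (r₀ + 1))) = 1)
    {w : ℂ} (hw : Valued.v (ι.symm (w - 1)) < 1) :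
    ∃ x₀ : ℚ, Valued.v (ι.symm ((plusSymbol (∑ i, c i • φ i) x₀ -
      w * plusSymbol (∑ i, c i • φ i) (q * x₀)) / Ω)) = 1 := by
  classical
  haveI : Fact q.Prime := ⟨hq⟩
  haveI := charP_residueField (p := p)
  set res := IsLocalRing.residue (Valued.integer (PadicAlgCl p)) with hres
  set G := ∑ i, c i • φ i with hG
  have hplus : ∀ x : ℚ, plusSymbol G x = ∑ i, c i * (((modularSymbol (φ i) x).re : ℝ) : ℂ) :=
    fun x => plusSymbol_sum_smul_eq_re φ c hreal x
  -- some `φ i₀ ≠ 0` (else `plusSymbol G ≡ 0`, against the unit value)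
  have hi₀ : ∃ i₀, φ i₀ ≠ 0 := by
    by_contra hall
    push Not at hall
    have h0 : plusSymbol G ((((γ₀ : SL(2, ℤ)) 0 0 : ℤ) : ℚ) / (((γ₀ : SL(2, ℤ)) 1 0 : ℤ) : ℚ)) = 0 := by
      rw [hplus]
      refine Finset.sum_eq_zero fun i _ ↦ ?_
      simp [hall i, modularSymbol]
    rw [h0, zero_div, map_zero, Valuation.map_zero] at hunit
    exact zero_ne_one hunit
  obtain ⟨i₀, hi₀⟩ := hi₀
  have huniq : ∀ {a b : ℂ}, a • φ i₀ = b • φ i₀ → a = b := fun h => smul_left_injective ℂ hi₀ h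
  -- (a) the eigencharacter on `𝕋̃`: `toEnd s (φ i) = lam s • φ i`, `lam s` real integral
  choose lam hlam using fun s : HeckeRing0.primeTo N 2 (N * q) => exists_eigenvalue_primeTo_family hφT he s
  have hlamA : ∀ s : HeckeRing0.primeTo N 2 (N * q),
      (∀ i, HeckeRing0.toEnd N 2 (s : HeckeRing0 N 2) (φ i) = lam s • φ i) ∧ ‖ι.symm (lam s)‖ ≤ 1 ∧ (lam s).im = 0 :=
    fun s => ⟨(hlam s).1, PadicAlgCl.norm_le_one_of_isIntegral p ((hlam s).2.1.map (ι.symm : ℂ →+* PadicAlgCl p).toIntAlgHom),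
      (hlam s).2.2⟩
  let lamHom : HeckeRing0.primeTo N 2 (N * q) →+* ℂ :=
    { toFun := lam
      map_one' := by
        refine huniq ?_
        rw [← (hlamA 1).1 i₀, OneMemClass.coe_one, map_one, Module.End.one_apply, one_smul]
      map_mul' := fun s s' => by
        refine huniq ?_
        rw [← (hlamA (s * s')).1 i₀, Subalgebra.coe_mul, map_mul, Module.End.mul_apply, (hlamA s').1 i₀, map_smul,
          (hlamA s).1 i₀, smul_smul, mul_comm]
      map_zero' := by
        refine huniq ?_
        rw [← (hlamA 0).1 i₀, ZeroMemClass.coe_zero, map_zero, LinearMap.zero_apply, zero_smul]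
      map_add' := fun s s' => by
        refine huniq ?_
        rw [← (hlamA (s + s')).1 i₀, Subalgebra.coe_add, map_add, LinearMap.add_apply, (hlamA s).1 i₀,
          (hlamA s').1 i₀, add_smul] }
  have hlamHom : ∀ s, lamHom s = lam s := fun _ => rfl
  -- (b) `χ : 𝕋̃ → 𝓀`
  let χ₀ : HeckeRing0.primeTo N 2 (N * q) →+* (Valued.integer (PadicAlgCl p)) :=
    ((ι.symm : ℂ →+* PadicAlgCl p).comp lamHom).codRestrict (Valued.integer (PadicAlgCl p)) fun s =>
      mem_integer_iff_norm_le_one.mpr (hlamA s).2.1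
  have hχ₀ : ∀ s, (χ₀ s : PadicAlgCl p) = ι.symm (lam s) := fun _ => rfl
  let χ : HeckeRing0.primeTo N 2 (N * q) →+* IsLocalRing.ResidueField (Valued.integer (PadicAlgCl p)) :=
    res.comp χ₀
  have hχ : ∀ s, χ s = res (χ₀ s) := fun _ => rfl
  -- (c) `ker χ` is maximal
  have hpker : ((p : ℕ) : HeckeRing0.primeTo N 2 (N * q)) ∈ RingHom.ker χ := by
    rw [RingHom.mem_ker, map_natCast]
    exact CharP.cast_eq_zero _ p
  haveI hfinT : Module.Finite ℤ (HeckeRing0.primeTo N 2 (N * q)) :=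
    Module.Finite.of_injective (HeckeRing0.primeTo N 2 (N * q)).val.toLinearMap Subtype.val_injective
  have h𝔫 : (RingHom.ker χ).IsMaximal := by
    set Q := HeckeRing0.primeTo N 2 (N * q) ⧸ RingHom.ker χ with hQ
    haveI : IsDomain Q := (RingHom.quotientKerEquivRange χ).toMulEquiv.isDomain
    haveI : Module.Finite ℤ Q := Module.Finite.of_surjective
      (Ideal.Quotient.mkₐ ℤ (RingHom.ker χ)).toLinearMap (Ideal.Quotient.mkₐ_surjective ℤ _)
    haveI : AddGroup.FG Q := Module.Finite.iff_addGroup_fg.mp inferInstance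
    have hpQ : ((p : ℕ) : Q) = 0 := by
      have h := Ideal.Quotient.eq_zero_iff_mem.mpr hpker
      rwa [map_natCast] at h
    have htors : AddMonoid.IsTorsion Q := by
      intro x
      rw [isOfFinAddOrder_iff_nsmul_eq_zero]
      refine ⟨p, (Fact.out : p.Prime).pos, ?_⟩
      rw [nsmul_eq_mul, hpQ, zero_mul]
    haveI : Finite Q := AddCommGroup.finite_of_fg_torsion Q htors
    exact Ideal.Quotient.maximal_of_isField _ (Finite.isField_of_domain Q)
  have h2 : (2 : IsLocalRing.ResidueField (Valued.integer (PadicAlgCl p))) ≠ 0 := two_ne_zero_residueField hp2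
  -- (d) `ker χ` is not Eisenstein: the numeral `r₀`
  have hE : ¬ HeckeRing0.primeTo.IsEisenstein (RingHom.ker χ) := by
    intro hEis
    have hmem := hEis r₀ hr₀ hr₀S hr₀1
    rw [RingHom.mem_ker, map_sub, hχ] at hmem
    have hT : lam (HeckeRing0.primeTo.T N 2 (N * q) hr₀ hr₀S) = e r₀ := by
      refine huniq ?_
      rw [← (hlamA _).1 i₀]
      show HeckeRing0.toEnd N 2 (HeckeRing0.T N 2 r₀ hr₀) (φ i₀) = e r₀ • φ i₀
      rw [HeckeRing0.toEnd_T]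
      exact hφT i₀ r₀ hr₀ hr₀S
    have hval : res (χ₀ (HeckeRing0.primeTo.T N 2 (N * q) hr₀ hr₀S)) -
        ((r₀ : IsLocalRing.ResidueField (Valued.integer (PadicAlgCl p))) + 1) = 0 := by
      have : χ ((r₀ : HeckeRing0.primeTo N 2 (N * q)) + 1) =
          (r₀ : IsLocalRing.ResidueField (Valued.integer (PadicAlgCl p))) + 1 := by
        rw [map_add, map_natCast, map_one]
      rwa [this] at hmem
    have hmemO : ι.symm (e r₀ - (r₀ + 1)) ∈ (Valued.integer (PadicAlgCl p)) :=
      mem_integer_iff_norm_le_one.mpr (valuation_eq_one_iff.mp hE₀).le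
    have hunit' : res ⟨ι.symm (e r₀ - (r₀ + 1)), hmemO⟩ ≠ 0 := by
      rw [Ne, IsLocalRing.residue_eq_zero_iff, IsLocalRing.mem_maximalIdeal, mem_nonunits_iff, not_not,
        Valuation.Integers.isUnit_iff_valuation_eq_one (Valuation.integer.integers _)]
      exact hE₀
    apply hunit'
    have heq : (⟨ι.symm (e r₀ - (r₀ + 1)), hmemO⟩ : (Valued.integer (PadicAlgCl p))) =
        χ₀ (HeckeRing0.primeTo.T N 2 (N * q) hr₀ hr₀S) - ((r₀ : (Valued.integer (PadicAlgCl p))) + 1) := by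
      apply Subtype.ext
      push_cast
      rw [hχ₀, hT, map_sub, map_add, map_natCast, map_one]
    rw [heq, map_sub, map_add, map_natCast, map_one]
    exact hval
  -- (e) the cycle functional `Λ`
  let R : ℂ → IsLocalRing.ResidueField (Valued.integer (PadicAlgCl p)) := fun z =>
    if h : ‖ι.symm z‖ ≤ 1 then res ⟨ι.symm z, mem_integer_iff_norm_le_one.mpr h⟩ else 0
  have hR : ∀ {z : ℂ} (h : ‖ι.symm z‖ ≤ 1), R z = res ⟨ι.symm z, mem_integer_iff_norm_le_one.mpr h⟩ :=
    fun h => dif_pos h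
  let P : Module.Dual ℂ (CuspForm (Gamma0 N) 2) → ℂ := fun y => ∑ i, c i * (((y (φ i)).re : ℝ) : ℂ)
  let Λ : Module.Dual ℂ (CuspForm (Gamma0 N) 2) → IsLocalRing.ResidueField (Valued.integer (PadicAlgCl p)) :=
    fun y => R (P y / Ω)
  let μ : ℚ → IsLocalRing.ResidueField (Valued.integer (PadicAlgCl p)) := fun r => R (plusSymbol G r / Ω)
  have hcycle : ∀ x ∈ periodHomology N, ‖ι.symm (P x / Ω)‖ ≤ 1 := by
    intro x hx
    have hx' : x ∈ (periodHomology N : Set (Module.Dual ℂ (CuspForm (Gamma0 N) 2))) := hx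
    rw [coe_periodHomology_eq_range] at hx'
    obtain ⟨γ, rfl⟩ := hx'
    show ‖ι.symm ((∑ i, c i * ((((periodFunctional N γ (φ i)).re : ℝ) : ℂ))) / Ω)‖ ≤ 1
    simp only [periodFunctional_apply, cuspSymbol]
    split_ifs with hc0
    · simp only [Complex.zero_re, Complex.ofReal_zero, mul_zero, Finset.sum_const_zero, zero_div, map_zero, norm_zero]
      exact zero_le_one
    · rw [← hplus]
      exact valuation_le_one_iff.mp (hΩint _)
  have hΛ : ∀ (s : HeckeRing0.primeTo N 2 (N * q)), ∀ x ∈ periodHomology N,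
      Λ ((s : HeckeRing0 N 2) • x) = χ s * Λ x := by
    intro s x hx
    obtain ⟨hsA, hint, hrl⟩ := hlamA s
    have hsx : ∀ i, ((s : HeckeRing0 N 2) • x) (φ i) = lam s * x (φ i) := by
      intro i
      rw [HeckeRing0.smul_dual_apply, hsA i, map_smul, smul_eq_mul]
    have hreal_lam : ∀ z : ℂ, (((lam s * z).re : ℝ) : ℂ) = lam s * (((z.re : ℝ) : ℂ)) := by
      intro z
      rw [Complex.mul_re, hrl, zero_mul, sub_zero, Complex.ofReal_mul]
      congr 1
      exact Complex.ext (by simp) (by simp [hrl])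
    have hre : P ((s : HeckeRing0 N 2) • x) / Ω = lam s * (P x / Ω) := by
      show (∑ i, c i * (((((s : HeckeRing0 N 2) • x) (φ i)).re : ℝ) : ℂ)) / Ω =
        lam s * ((∑ i, c i * (((x (φ i)).re : ℝ) : ℂ)) / Ω)
      simp only [hsx, hreal_lam]
      rw [mul_div_assoc', Finset.mul_sum]
      congr 1
      refine Finset.sum_congr rfl fun i _ ↦ ?_
      ring
    have h1' : ‖ι.symm (lam s)‖ ≤ 1 := hint
    have h2' := hcycle x hx
    have h12 : ‖ι.symm (lam s * (P x / Ω))‖ ≤ 1 := by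
      rw [map_mul, norm_mul]; exact mul_le_one₀ h1' (norm_nonneg _) h2'
    show R _ = χ s * R _
    rw [hre, hR h12, hR h2', hχ, ← map_mul]
    congr 1
    apply Subtype.ext
    push_cast
    rw [map_mul, hχ₀]
  have hμΛ : ∀ y ∈ periodHomology N, ∀ r : ℚ,
      (∀ f : CuspForm (Gamma0 N) 2, y f = modularSymbol f r) → μ r = Λ y := by
    intro y _ r hy
    show R _ = R ((∑ i, c i * (((y (φ i)).re : ℝ) : ℂ)) / Ω)
    rw [hplus r]
    simp only [hy]
  have hx₀ : periodFunctional N γ₀ ∈ periodHomology N := periodFunctional_mem_periodHomology N γ₀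
  have hΛx : Λ (periodFunctional N γ₀) ≠ 0 := by
    have hPγ : P (periodFunctional N γ₀) / Ω =
        plusSymbol G ((((γ₀ : SL(2, ℤ)) 0 0 : ℤ) : ℚ) / (((γ₀ : SL(2, ℤ)) 1 0 : ℤ) : ℚ)) / Ω := by
      show (∑ i, c i * ((((periodFunctional N γ₀ (φ i)).re : ℝ) : ℂ))) / Ω = _
      simp only [periodFunctional_apply, cuspSymbol, if_neg hγ₀]
      rw [hplus]
    show R _ ≠ 0
    rw [hPγ, hR (valuation_eq_one_iff.mp hunit).le]
    rw [Ne, IsLocalRing.residue_eq_zero_iff, IsLocalRing.mem_maximalIdeal, mem_nonunits_iff, not_not,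
      Valuation.Integers.isUnit_iff_valuation_eq_one (Valuation.integer.integers _)]
    exact hunit
  -- (f) Ihara
  obtain ⟨r, hr⟩ := exists_sub_mul_apply_ne_zero_of_ribet1984_iharaLemma hI hqN Λ χ hΛ h𝔫 h2 hE hx₀ hΛx
    (1 : IsLocalRing.ResidueField (Valued.integer (PadicAlgCl p))) hμΛ
  refine ⟨r, ?_⟩
  have hA' := valuation_le_one_iff.mp (hΩint r)
  have hB' := valuation_le_one_iff.mp (hΩint (q * r))
  have hC : ‖ι.symm w‖ ≤ 1 := by
    have : ι.symm w = ι.symm (w - 1) + 1 := by rw [map_sub, map_one, sub_add_cancel]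
    rw [this]
    exact (PadicAlgCl.isNonarchimedean p _ _).trans (max_le (valuation_lt_one_iff.mp hw).le (by rw [norm_one]))
  have hc1 : res ⟨ι.symm w, mem_integer_iff_norm_le_one.mpr hC⟩ = 1 := by
    have h := residue_mk_eq_of_norm_sub_lt_one (mem_integer_iff_norm_le_one.mpr hC)
      (one_mem (Valued.integer (PadicAlgCl p))) (by
      rw [← map_one ι.symm, ← map_sub]; exact valuation_lt_one_iff.mp hw)
    rw [h]; exact map_one res
  have hABC : ‖ι.symm ((plusSymbol G r - w * plusSymbol G (q * r)) / Ω)‖ ≤ 1 := by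
    rw [sub_div, mul_div_assoc, map_sub, map_mul, sub_eq_add_neg]
    refine (PadicAlgCl.isNonarchimedean p _ _).trans (max_le hA' ?_)
    rw [norm_neg, norm_mul]; exact mul_le_one₀ hC (norm_nonneg _) hB'
  have hresid : res ⟨ι.symm ((plusSymbol G r - w * plusSymbol G (q * r)) / Ω), mem_integer_iff_norm_le_one.mpr hABC⟩ =
      μ r - 1 * μ (q * r) := by
    show _ = R _ - 1 * R _
    rw [hR hA', hR hB', ← hc1, ← map_mul, ← map_sub]
    congr 1
    apply Subtype.ext
    push_cast
    rw [sub_div, mul_div_assoc, map_sub, map_mul]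
  refine valuation_eq_one_iff.mpr (le_antisymm hABC ?_)
  by_contra hlt
  push Not at hlt
  apply hr
  rw [← hresid]
  exact residue_mk_eq_zero_of_norm_lt_one _ hlt

end Ihara

end Summit.BirchSwinnertonDyer.BirchSwinnertonDyer.Theorems.GL1Cartan.Exc

end
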